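import Summits.QuantumFields.YangMills.Theorems.BalabanUVNodesK0Stub1BHolds
import Literature.MathematicalPhysics.QuantumFieldTheory.Balaban1983to89.B8Prop6PrintedZdCubPGamma
import Summits.QuantumFields.YangMills.Theorems.BalabanUVNodesK0AllTorusOfStepTokensGuardedZBLamPrintAx
import Summits.QuantumFields.YangMills.Theorems.BalabanUVNodesK0V23Stub3NonVacuity

/-!
# K0ᴬ (stmt-QuantumFields-27238 `Record13SepCoPHInhabitedAx`) — `…K0V23Stub3NonVacuity` RE-CENTRED (OP 5a ∕ H3.3, the Ax EDITION): the [15] antecedents of the re-centred stub-3ᴬ′ᴮ text are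
# INHABITED below a radius (stub 1ᴮ PROVED, antitone in the radius), so the text `K0V23DefsAx.AbsBetaBoxAtThm1WitnessCCMGenGridGZBAxAt F` ⟺ the TOKEN-FREE box core of `β₁₃ᴬˣ(F; a₀, ε₂₉)` on `(0, ā(F)]`

Cell `pub-ymgap` (YM-PLAN Track A, D-0062), width seat `pub-ymgap-dag-n07-w3` (g22; N07 ∕ K0–K1 junction; OP 5a H3.3 Ax editions, `--supports stmt-QuantumFields-27238 --as helper`).
COUNT-NEUTRAL; theorems only — 0 `def` ∕ `sorry` ∕ `instance` ∕ `notation`; NEW additive leaf — dag-n07-w3 g16's `…K0V23Stub3NonVacuity` (201 l., key 20541 = K0⁷, banked as an aside by director-ym №467 (D))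
stays landed and true on its own text; nothing in the tree is edited.

WHAT THIS FILE IS.  The σ-IMAGE of `…K0V23Stub3NonVacuity` under director-ym №467 (D)'s re-centring of K0 (K0⁷ `Record13SepCoPHInhabited` ↦ K0ᴬ `Record13SepCoPHInhabitedAx`, stmt-QuantumFields-27238):
σ = { `theta13OfThm1CCMWZB ↦ theta13OfThm1CCMWZBAx` (def-Y (c), SAME ARITY; letters `X_theta13OfThm1CCMWZBAx` of (c) ∕ (d)), `betaOfRecord₁₃ ↦ betaOfRecord₁₃Ax`, `gOfRecord₁₃ ↦ gOfRecord₁₃Ax`,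
`Provisos₁₃SepCoPH ∕ SlotsNondegenerate₁₃ ↦ …Ax`, `UbgOfRecord₁₃CoP θ ↦ UbgOfRecord₁₃CoPChi θ (chiβOfRecord₁₃Ax θ)`, `PartCompat₁₃ θ ↦ PartCompat₁₃Chi θ (chiβOfRecord₁₃Ax θ)`, texts
`K0V23Defs.AbsBetaBox…GZB{,Eps0}At ↦ K0V23DefsAx.…AxAt` (p803783; `Prop8StepCoPGridGBAt`, `K0N09Eps0LetterAt` CENTRE-BLIND, verbatim), door module `…GuardedZBLam{,Print} ↦ …Ax` (p805243 ∕ p806943) }.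
Every proof is the source's proof term under σ; theorem names are the source's (new namespace `…Ax`).
HONEST FRAMING OF THE EDITION (binding; the source's framing below carries over verbatim under σ).  Count-neutral kernel bookkeeping; nothing of Bałaban asserted, valued or discharged;
every theorem CONDITIONAL on its displayed hypotheses (the re-centred stub-3 text ∕ NODE O's wall is inhabited nowhere); K0ᴬ 27238 ∕ K1ᴬ 27239 ∕ K3ᴬ 27247 OPEN; N07 ∕ N09 NOT discharged;
COUNT 8∕28 · K 1∕4 UNMOVED; R4 = the CONDITIONAL finite-𝕋⁴ rung `BalabanLadder.UV` only — NOT continuum ∕ ℝ⁴ ∕ OS; **the Yang–Mills mass gap (Clay) is NOT proved by any of this.**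

── THE SOURCE's OWN ACCOUNT (σ-applied; «K0⁷» there reads «K0ᴬ» here, «V23 text» reads «re-centred text (V24 candidate, registered by plan g99 — not here)») ──
WHY (the point a refuter presses on every ∀-over-antecedents stub; dag-n07-w3 g15's A6ᴮ ∕ A6ᴮ-2 ✓p767123 ∕ ✓p767712 answered it for stub 1ᴮ).  The re-centred 3ᴬ′ᴮ text (V24 candidate) is
`∀ (j c c₀ c₁; B₃ B₃′ a₀ a₁), riders → ᴮ(8)-sentence → ᴮ(9)-token → ∃ box`; were the two [15] antecedents jointly UNINHABITED at every radius, the stub would close by `fun … h15 h9 => absurd`,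
moving nothing.  THIS FILE closes that door in the kernel: §2 the antecedents are ANTITONE in `(a₀, a₁)` (F0c ∕ S1a-C ∕ S1b-1 `.of_le`), so the radii at which they are inhabited form a
DOWN-SET; §3 that down-set contains `(0, ā]` for an explicit-by-name `ā > 0` — stub 1ᴮ's own radius (✓p767981), pushed through 53′ and the (9)-supplier with [6] Prop. 6 printed; §4 hence
(the easy half of INTENT-1 §2 «text ⟺ uniform core», inlined with the `rfl` census) ★★★ `tokenFreeZB_below_of_absBetaBoxGZBAt`: the V23 text at `F` yields the token-free core at EVERY radius `a₀ ∈ (0, ā]`, in particular ★★ ONE genuine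
box `exists_absBetaBox_of_absBetaBoxGZBAt`; the `∀ F` forms for the skeleton's stub.  So 3ᴬ′ᴮ is EXACTLY as strong as NODE O's wall on small radii — no cheap close exists.

HONEST FRAMING (binding).  Kernel bookkeeping over LANDED theorems + one `rfl` census; NO β estimate; the abs β-box is PROVED NOWHERE here (every §4 statement is CONDITIONAL on the V23
text — which is NOT proved and, by this file, NOT vacuous); [6] Prop. 6 enters only through the green Literature theorem already consumed by the V23 skeleton; nothing of Bałaban's asserted
anew; no value of `a₀ ∕ ε₀ ∕ ε₂₉` chosen for anybody (`ā` is stub 1ᴮ's ∃-radius, read by `obtain`, never pinned); V23 NOT registered by this file; K0ᴬ stmt-QuantumFields-27238 NOT closed;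
N07 NOT discharged; K1⁹ ∕ K3⁸ OPEN; counts UNMOVED (typed 28∕28 · discharged 8∕28, route display 8∕27 excl. NODE O; K 1∕4); R4 = the CONDITIONAL finite-𝕋⁴ rung `BalabanLadder.UV` at fixed
`ε = L^(−K)` only — NOT continuum ∕ ℝ⁴ ∕ OS; the Yang–Mills mass gap (Clay) is NOT proved by any of this.  Standard axioms only.
-/

noncomputable section

open scoped Matrix.Norms.L2Operator

namespace Summit.QuantumFields.YangMills.Theorems.K0V23Stub3NonVacuityAx

open Literature.MathematicalPhysics.QuantumFieldTheory.Balaban1983to89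
open Literature.MathematicalPhysics.QuantumFieldTheory.Balaban1983to89.Node00
open Literature.MathematicalPhysics.QuantumFieldTheory.Balaban1983to89.T4Continuum
open Literature.MathematicalPhysics.QuantumFieldTheory.Balaban1983to89.FlowStep
open Literature.MathematicalPhysics.QuantumFieldTheory.Balaban1983to89.B15DeterminingSets
open Literature.MathematicalPhysics.QuantumFieldTheory.Balaban1983to89.B8LeafModelZd (ZdIdx)
open Literature.MathematicalPhysics.QuantumFieldTheory.Balaban1983to89.B8Prop6PrintedZdCubPGamma (prop6Printed_zdCubP_γ_holds_pos)
open Summit.QuantumFields.YangMills.Theorems.K0V23DefsAx (AbsBetaBoxAtThm1WitnessCCMGenGridGZBAxAt AbsBetaBoxAtThm1WitnessCCMGenGridGZBEps0AxAt absBetaBoxGenGridGZBAxAt_of_eps0)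
open Summit.QuantumFields.YangMills.BalabanUVNodes.K0Stub1BHolds (prop8StepCoPGridGBAt_holds)
open Summit.QuantumFields.YangMills.BalabanUVNodes.N07Thm1Top7FromProp8GuardedB (variationalThm1RegSepCoP7MGB_of_prop8TopStepGB_lamDatum)
open Summit.QuantumFields.YangMills.Theorems.K0PrintCubeOfStepTokensGridGuardedB (gauge9SupplierG3B_of_prop6MemberP)
open Summit.QuantumFields.YangMills.Theorems.K0V23Stub3NonVacuity (antecedentsZB_inhabited_antitone exists_radius_antecedentsZB_inhabited_below)

variable (F : T4Family)

/-! ## §1  The stub-2′ text from [6] Proposition 6 AS PRINTED (green Literature; the V23 skeleton's F4 supply — `private`, no public supplier by design) -/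

/-- [6] Prop. 6 as printed on print's class at `d = 4`, `𝔸 = M₂(ℂ)`, `L = F.L`, index map `id` (`0 < B₁` weakened to `0 ≤ B₁`) — the door's `h2P` binder, exactly as the V23 skeleton's §3b
discharges it.  PRIVATE (a public copy would be a second supplier of a landed statement). [cite: Balaban1985RegularSpaces, Prop. 6 (1.135)–(1.138) p.99, (1.3)–(1.6) p.77] -/
private theorem twoPrime :
    ∃ (ρ₀ : ℕ) (B₁ c₁ : ℝ), 1 ≤ ρ₀ ∧ 0 ≤ B₁ ∧ 0 < c₁ ∧
      (letI : CStarAlgebra (MatA 2) := {}; B8.Prop6Printed 4 (F.L : ℝ) B₁ c₁ (fun i : ZdIdx 4 F.L => zdCubP (MatA 2) F.L ρ₀ i)) := by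
  letI : CStarAlgebra (MatA 2) := {}
  have hL5 : 5 ≤ F.L := by have := F.hL11; omega
  obtain ⟨ρ₀, B₁, c₁, hρ₀, hB₁, hc₁, H⟩ :=
    prop6Printed_zdCubP_γ_holds_pos (𝔸 := MatA 2) (d := 4) (by norm_num) hL5 F.hL.1
  exact ⟨ρ₀, B₁, c₁, hρ₀, hB₁.le, hc₁, H (fun i : ZdIdx 4 F.L => i)⟩

/-- Letter census at the print-regime Z3 member (`rfl`; = ✓p769914 `K0V23Stub3SocketsAx.betaOfRecord₁₃_zbRegime_letterBlind`, kept `private` here so that this file stays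
route-independent): β of record there reads only `(a₀, ε₂₉)`. [cite: Balaban1987RG1, (1.20)–(1.22) p.264, (1.6) p.261, (0.21) p.256, (2.9) p.266 (bookkeeping)] -/
private theorem census (j j' : ℕ) (a₀ ε₀ ε₀' ε₂₉ B₃ C₃ B₃' C₃' a₁ c₁ : ℝ) (Efl logz Efl' logz' : B12.RunParams → ℕ → ℝ) :
    betaOfRecord₁₃Ax F 2 (theta13OfThm1CCMWZBAx F 2 j (1 / 2) a₀ ε₀ ε₂₉ B₃ B₃' a₀ a₁ Efl logz) =
      betaOfRecord₁₃Ax F 2 (theta13OfThm1CCMWZBAx F 2 j' (1 / 2) a₀ ε₀' ε₂₉ C₃ C₃' a₀ c₁ Efl' logz') := rfl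

/-! ## §2  The radii at which the two ᴮ antecedents of 3ᴬ′ᴮ are jointly inhabited form a DOWN-SET -/

/-! ## §3  ★ The down-set contains `(0, ā]`: stub 1ᴮ (PROVED) + 53′ + the (9)-supplier with [6] Prop. 6 printed -/

/-! ## §4  ★★★ Hence the V23 stub-3 text FORCES the token-free core on `(0, ā]` — 3ᴬ′ᴮ is not vacuously closable -/

/-- **★★★ THE V23 3ᴬ′ᴮ TEXT AT `F` YIELDS NODE O's BILL ON A WHOLE INTERVAL OF RADII**: if `K0V23DefsAx.AbsBetaBoxAtThm1WitnessCCMGenGridGZBAxAt F` holds then there is `ā > 0` such that for EVERY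
radius `a₀ ∈ (0, ā]` SOME `γ₀, ε₂₉ > 0` and `β′` box the β-functions of record of the print-regime Z3 member — `−β′ ≤ β₁₃(F; a₀, ε₂₉)_{k+1}(v) ≤ β′` for all `k` and all `v ∈ ]0, γ₀]^{k+1}` — at
every member `(j, ε₀, B₃, B₃′, a₁, Efl, logz)`.  (§3 + the easy half of ✓p769914 `K0V23Stub3SocketsAx.absBetaBoxGZBAt_iff_uniformZB`, inlined.)  CONSEQUENCE: any proof of the V23 skeleton's `stub_absBetaBoxAtThm1WitnessCCMGenGridGZB13`
proves a genuine uniform |β| box of [I] (1.20)–(1.22) at small radii ([I] §1 p.264 «uniformly bounded», proof unpublished [II] p.355) — the stub is NOT weaker than the wall there.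
CONDITIONAL on the V23 text; nothing asserted. [cite: Balaban1987RG1, Thm 1 p.259, §1 (1.20)–(1.22) p.264, (2.9) p.266, (0.1) p.251; Balaban1985Variational, Thm 1 (8)–(9) p.279, Prop. 8 p.304; Balaban1985RegularSpaces, Prop. 6 p.99; Balaban1984PropagatorsII, (2.3) p.224; Balaban1989LargeFieldII, p.355] -/
theorem tokenFreeZB_below_of_absBetaBoxGZBAt (h : AbsBetaBoxAtThm1WitnessCCMGenGridGZBAxAt F) :
    ∃ ā : ℝ, 0 < ā ∧ ∀ a₀ : ℝ, 0 < a₀ → a₀ ≤ ā →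
      ∃ γ₀ ε₂₉ β' : ℝ, 0 < γ₀ ∧ 0 < ε₂₉ ∧ ∀ (j : ℕ) (ε₀ B₃ B₃' a₁ : ℝ) (Efl logz : B12.RunParams → ℕ → ℝ),
        BetaLowerH (-β') γ₀ (betaOfRecord₁₃Ax F 2 (theta13OfThm1CCMWZBAx F 2 j (1 / 2) a₀ ε₀ ε₂₉ B₃ B₃' a₀ a₁ Efl logz)) ∧
        BetaUpperH β' γ₀ (betaOfRecord₁₃Ax F 2 (theta13OfThm1CCMWZBAx F 2 j (1 / 2) a₀ ε₀ ε₂₉ B₃ B₃' a₀ a₁ Efl logz)) := by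
  obtain ⟨ā, hā, hinh⟩ := exists_radius_antecedentsZB_inhabited_below F
  refine ⟨ā, hā, fun a₀ ha₀ ha₀le => ?_⟩
  obtain ⟨j, c, c₀, c₁, B₃, B₃', a₁, hc, hc₀, hc₁, hB₃, hB₃', ha₁, h15, h9⟩ := hinh a₀ ha₀ ha₀le
  obtain ⟨γ₀, ε₀, ε₂₉, β', hγ₀, -, hε', hlow, hup⟩ := h j c c₀ c₁ B₃ B₃' a₀ a₁ hc hc₀ hc₁ hB₃ hB₃' ha₀ ha₁ h15 h9
  refine ⟨γ₀, ε₂₉, β', hγ₀, hε', fun j' ε₀' C₃ C₃' c₁' Efl' logz' => ?_⟩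
  rw [← census F j j' a₀ ε₀ ε₀' ε₂₉ B₃ C₃ B₃' C₃' a₁ c₁' (fun _ _ => 0) (fun _ _ => 0) Efl' logz']
  exact ⟨hlow, hup⟩

/-- **★★ IN PARTICULAR ONE GENUINE BOX**: the re-centred 3ᴬ′ᴮ text (V24 candidate) at `F` yields a radius `a₀ > 0`, a window `γ₀ > 0`, a threshold `ε₂₉ > 0` and a bound `β′` with the sign-free box of
`β₁₃(F; a₀, ε₂₉)` (displayed at the letter-free member `θ₁₃ᶜᶜᴹᵂᶻᴮ(0; ½; a₀; a₀, ε₂₉; 0, 0, a₀, 0; 0, 0)` — any member has the same β, `rfl`).  So the stub cannot be closed by an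
uninhabited antecedent.  CONDITIONAL on the V23 text. [cite: Balaban1987RG1, Thm 1 p.259, §1 (1.20)–(1.22) p.264; Balaban1985Variational, Thm 1 (8)–(9) p.279; Balaban1989LargeFieldII, p.355] -/
theorem exists_absBetaBox_of_absBetaBoxGZBAt (h : AbsBetaBoxAtThm1WitnessCCMGenGridGZBAxAt F) :
    ∃ a₀ γ₀ ε₂₉ β' : ℝ, 0 < a₀ ∧ 0 < γ₀ ∧ 0 < ε₂₉ ∧
      BetaLowerH (-β') γ₀ (betaOfRecord₁₃Ax F 2 (theta13OfThm1CCMWZBAx F 2 0 (1 / 2) a₀ a₀ ε₂₉ 0 0 a₀ 0 (fun _ _ => 0) (fun _ _ => 0))) ∧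
      BetaUpperH β' γ₀ (betaOfRecord₁₃Ax F 2 (theta13OfThm1CCMWZBAx F 2 0 (1 / 2) a₀ a₀ ε₂₉ 0 0 a₀ 0 (fun _ _ => 0) (fun _ _ => 0))) := by
  obtain ⟨ā, hā, hall⟩ := tokenFreeZB_below_of_absBetaBoxGZBAt F h
  obtain ⟨γ₀, ε₂₉, β', hγ₀, hε', hbox⟩ := hall ā hā le_rfl
  exact ⟨ā, γ₀, ε₂₉, β', hā, hγ₀, hε', hbox 0 ā 0 0 0 (fun _ _ => 0) (fun _ _ => 0)⟩

/-- **The `∀ F` form for the skeleton's stub**: `∀ F, …GZBAt F` (the type of `stub_absBetaBoxAtThm1WitnessCCMGenGridGZB13`) delivers NODE O's bill on `(0, ā_F]` at every family.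
CONDITIONAL. [cite: Balaban1987RG1, Thm 1 p.259, §1 (1.20)–(1.22) p.264; Balaban1985Variational, Thm 1 (8)–(9) p.279; Balaban1989LargeFieldII, p.355] -/
theorem forall_tokenFreeZB_below_of_forall_absBetaBoxGZBAt (h3 : ∀ F : T4Family, AbsBetaBoxAtThm1WitnessCCMGenGridGZBAxAt F) :
    ∀ F : T4Family, ∃ ā : ℝ, 0 < ā ∧ ∀ a₀ : ℝ, 0 < a₀ → a₀ ≤ ā →
      ∃ γ₀ ε₂₉ β' : ℝ, 0 < γ₀ ∧ 0 < ε₂₉ ∧ ∀ (j : ℕ) (ε₀ B₃ B₃' a₁ : ℝ) (Efl logz : B12.RunParams → ℕ → ℝ),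
        BetaLowerH (-β') γ₀ (betaOfRecord₁₃Ax F 2 (theta13OfThm1CCMWZBAx F 2 j (1 / 2) a₀ ε₀ ε₂₉ B₃ B₃' a₀ a₁ Efl logz)) ∧
        BetaUpperH β' γ₀ (betaOfRecord₁₃Ax F 2 (theta13OfThm1CCMWZBAx F 2 j (1 / 2) a₀ ε₀ ε₂₉ B₃ B₃' a₀ a₁ Efl logz)) :=
  fun F => tokenFreeZB_below_of_absBetaBoxGZBAt F (h3 F)

/-- **The strengthened text of LOCATED-K0ε₀** `…GZBEps0At F` forces the same bill (it implies the V23 text, ✓p767853 `absBetaBoxGenGridGZBAxAt_of_eps0`).  CONDITIONAL. [cite: Balaban1987RG1, Thm 1 p.259, (1.2) p.260, §1 (1.20)–(1.22) p.264; Balaban1985Variational, Thm 1 (8)–(9) p.279 (bookkeeping)] -/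
theorem tokenFreeZB_below_of_absBetaBoxGZBEps0At (h : AbsBetaBoxAtThm1WitnessCCMGenGridGZBEps0AxAt F) :
    ∃ ā : ℝ, 0 < ā ∧ ∀ a₀ : ℝ, 0 < a₀ → a₀ ≤ ā →
      ∃ γ₀ ε₂₉ β' : ℝ, 0 < γ₀ ∧ 0 < ε₂₉ ∧ ∀ (j : ℕ) (ε₀ B₃ B₃' a₁ : ℝ) (Efl logz : B12.RunParams → ℕ → ℝ),
        BetaLowerH (-β') γ₀ (betaOfRecord₁₃Ax F 2 (theta13OfThm1CCMWZBAx F 2 j (1 / 2) a₀ ε₀ ε₂₉ B₃ B₃' a₀ a₁ Efl logz)) ∧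
        BetaUpperH β' γ₀ (betaOfRecord₁₃Ax F 2 (theta13OfThm1CCMWZBAx F 2 j (1 / 2) a₀ ε₀ ε₂₉ B₃ B₃' a₀ a₁ Efl logz)) :=
  tokenFreeZB_below_of_absBetaBoxGZBAt F (absBetaBoxGenGridGZBAxAt_of_eps0 F h)

/-! ## §5  The exact shape of the stub: V23 text ⟺ the token-free core on the DOWN-SET of inhabited radii (which contains `(0, ā]`) -/

/-- **★ THE V23 3ᴬ′ᴮ TEXT ⟺ «the token-free core at every radius BELOW an inhabited one»**: since the inhabited radii form a down-set (§2), ✓p769914's uniform core (`K0V23Stub3SocketsAx.absBetaBoxGZBAt_iff_uniformZB`) can be read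
with the inhabitation witness taken at ANY radius `a ≥ a₀`.  With §3 the right-hand side always includes every `a₀ ∈ (0, ā]`.  A repackaging; nothing asserted. [cite: Balaban1987RG1, Thm 1 p.259, §1 (1.20)–(1.22) p.264, (2.9) p.266; Balaban1985Variational, Thm 1 (8)–(9) p.279; Balaban1984PropagatorsII, (2.3) p.224 (bookkeeping)] -/
theorem absBetaBoxGZBAt_iff_tokenFreeZB_belowInhabited :
    AbsBetaBoxAtThm1WitnessCCMGenGridGZBAxAt F ↔
      ∀ a₀ a : ℝ, 0 < a₀ → a₀ ≤ a →
        (∃ (j c c₀ c₁ : ℕ) (B₃ B₃' a₁ : ℝ), c ≤ F.L ^ j ∧ c₀ ≤ j + 1 ∧ c₁ ≤ j ∧ 2 * (F.L : ℝ) ^ 2 ≤ B₃ ∧ 0 < B₃' ∧ 0 < a₁ ∧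
          VariationalThm1RegSepCoP7MGB F 2
            (fun ν M g K k _s => c ≤ ν.M₁ ∧ k + c₀ ≤ F.m + K ∧ F.L ^ c₁ ∣ M ∧
              ∀ i, 1 ≤ i → i ≤ k → dCubeSide (F.P K).L M (RkOfRecord (F.P K).L ν.r (g i)) i ∣ (F.P K).sitesPerDir 0) (lamDatum F) (dataSmall7LamTopOf F 2) B₃ a a₁ ∧
          Gauge9RegSepTopStepGB F 2 (fun ν K Ω => suppDomOfRecord F ν K Ω) (F.L ^ j)
            (fun ν M g K k _s => c ≤ ν.M₁ ∧ k + c₀ ≤ F.m + K ∧ F.L ^ c₁ ∣ M ∧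
              ∀ i, 1 ≤ i → i ≤ k → dCubeSide (F.P K).L M (RkOfRecord (F.P K).L ν.r (g i)) i ∣ (F.P K).sitesPerDir 0) (lamDatum F) (dataSmall7LamTopOf F 2) B₃ B₃' a a₁) →
        ∃ γ₀ ε₂₉ β' : ℝ, 0 < γ₀ ∧ 0 < ε₂₉ ∧ ∀ (j : ℕ) (ε₀ B₃ B₃' a₁ : ℝ) (Efl logz : B12.RunParams → ℕ → ℝ),
          BetaLowerH (-β') γ₀ (betaOfRecord₁₃Ax F 2 (theta13OfThm1CCMWZBAx F 2 j (1 / 2) a₀ ε₀ ε₂₉ B₃ B₃' a₀ a₁ Efl logz)) ∧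
          BetaUpperH β' γ₀ (betaOfRecord₁₃Ax F 2 (theta13OfThm1CCMWZBAx F 2 j (1 / 2) a₀ ε₀ ε₂₉ B₃ B₃' a₀ a₁ Efl logz)) := by
  constructor
  · rintro h a₀ a ha₀ hle hinh
    obtain ⟨j, c, c₀, c₁, B₃, B₃', a₁, hc, hc₀, hc₁, hB₃, hB₃', ha₁, h15, h9⟩ := antecedentsZB_inhabited_antitone F hle hinh
    obtain ⟨γ₀, ε₀, ε₂₉, β', hγ₀, -, hε', hlow, hup⟩ := h j c c₀ c₁ B₃ B₃' a₀ a₁ hc hc₀ hc₁ hB₃ hB₃' ha₀ ha₁ h15 h9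
    refine ⟨γ₀, ε₂₉, β', hγ₀, hε', fun j' ε₀' C₃ C₃' c₁' Efl' logz' => ?_⟩
    rw [← census F j j' a₀ ε₀ ε₀' ε₂₉ B₃ C₃ B₃' C₃' a₁ c₁' (fun _ _ => 0) (fun _ _ => 0) Efl' logz']
    exact ⟨hlow, hup⟩
  · intro h j c c₀ c₁ B₃ B₃' a₀ a₁ hc hc₀ hc₁ hB₃ hB₃' ha₀ ha₁ h15 h9
    obtain ⟨γ₀, ε₂₉, β', hγ₀, hε', hall⟩ := h a₀ a₀ ha₀ le_rfl ⟨j, c, c₀, c₁, B₃, B₃', a₁, hc, hc₀, hc₁, hB₃, hB₃', ha₁, h15, h9⟩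
    exact ⟨γ₀, a₀, ε₂₉, β', hγ₀, ha₀, hε', hall j a₀ B₃ B₃' a₁ (fun _ _ => 0) (fun _ _ => 0)⟩

end Summit.QuantumFields.YangMills.Theorems.K0V23Stub3NonVacuityAx

end
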